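import Literature.Geometry.Lorentzian.InducedVacuumData
import Literature.Geometry.Lorentzian.ChartSecondFundamentalForm
import Literature.Geometry.Lorentzian.ChartMetricCoord
import Literature.Geometry.Lorentzian.CoordSliceNormal
import Literature.Geometry.Lorentzian.Basic
import Literature.Geometry.Lorentzian.Hypersurface
import Literature.Topology.FourManifolds.ImmersionCriterion
import Mathlib.Analysis.Convex.Star
import Mathlib.Analysis.Convex.PathConnected
import HarnessLib

/-!
# Coordinate slices `{x⁰ = 0}` of a chart domain of `E4` as immersed spacelike hypersurfaces

For a Lorentzian metric `g` on a chart domain `T : Opens E4` with representative `G`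
(`g.val x = G x`) and a chart domain `B : Opens E3` with `(0, y) ∈ T` for `y ∈ B`, this file sets
up the **slice embedding** `ι : B → T`, `y ↦ (0, y)` and its **normal field**
`ν y = N_{(0,y)} = -♯dt/√lapseSq` (`MetricCoord.sliceNormal`, `CoordSliceNormal.lean`; Wald 1984,
(10.2.10)) in the form required by the data-embedding structures of the tree
(`DataEmbedding`, `InducedVacuumData.lean`):

* `CoordSlice.dt`, `CoordSlice.incl` — the coordinate form `dt = dx⁰` and the linear inclusion
  `E3 → E4`, `v ↦ (0, v)` (the differential of `ι`), with the Euclidean bookkeeping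
  `norm_sq_eq`, `norm_ofTimeSpace_zero`, `norm_spatial_sub_le`;
* `CoordSlice.sliceEmbed`, `contMDiff_sliceEmbed`, `mfderiv_sliceEmbed_apply`,
  `isSmoothEmbedding_sliceEmbed` (an injective-differential immersion with the continuous left
  inverse `E4.spatial`; `isImmersion_of_injective_mfderiv`), `mem_range_sliceEmbed_iff`;
* `CoordSlice.sliceNormalField` and, where `lapseSq G dt > 0` along the slice (the slices are
  spacelike; Wald 1984, (10.2.10)): `isUnitNormal_sliceNormalField` (`g(ν, dι v) = 0`,
  `g(ν, ν) = -1`), `isSpacelikeImmersion_sliceEmbed` (`ι^* g > 0`, by the Lorentzian signature: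
  `ν^⊥` is spacelike, O'Neill 1983, Ch. 5, Lemma 5.26), `isFutureUnitNormal_sliceNormalField`
  (given future-directedness), `contMDiff_lift_sliceNormalField` (the lift `y ↦ (ι y, ν y)` is
  `C^∞`, `OpensChart.contMDiff_lift_of_contDiffOn` with `IsMetricOn.contDiffAt_sliceNormal`);
* `CoordSlice.exists_initialDataSet` — the induced initial data set `(ι^* g, K_ν)` on `B`
  (`PseudoRiemannianMetric.exists_initialDataSet_induced`; O'Neill 1983, Ch. 4, Lemma 4.4;
  Choquet-Bruhat 2009, Ch. VI);
* `CoordSlice.isConnected_lens` — the lens `{‖x - a‖ < ρ ∧ |dt x| + k ‖x - a‖ < δ}` over a slice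
  point `a` (`dt a = 0`) is star-shaped about `a`, hence connected (the spacetime of a local Cauchy
  development must be connected; Hawking–Ellis 1973, §7.4, Fig. 48).

Everything is proved; the definitions are abbreviations for explicit coordinate objects; no
named facts (D-0026). Consumer: the restart of the local uniqueness theorem from a spacelike
piece of the boundary of a common development (Sbierski 2016, §3.2, proof of Thm. 12).

## References

* R. M. Wald, *General Relativity*, Chicago 1984, §10.2, (10.2.10)–(10.2.13). [Wald1984]
* B. O'Neill, *Semi-Riemannian geometry with applications to relativity*, Academic Press 1983,
  Ch. 4, p. 97 and Lemma 4.4; Ch. 5, Lemma 5.26. [ONeillSemiRiemannian1983]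
* S. W. Hawking, G. F. R. Ellis, *The large scale structure of space-time*, CUP 1973, §7.4.
  [HawkingEllis1973CUP]
-/

noncomputable section

open Bundle Set Function Filter TopologicalSpace Manifold Module
open scoped Manifold ContDiff Topology

namespace Literature.Geometry.Lorentzian

namespace CoordSlice

/-! ### Linear algebra and norms of the slices `{x⁰ = t}` of `E4` -/

/-- The coordinate form `dt = dx⁰` on `E4`: `dt x = x 0`. [folklore] -/
def dt : E4 →L[ℝ] ℝ :=
  EuclideanSpace.proj 0

/-- `dt x = x 0`. [folklore] -/
@[simp]
theorem dt_apply (x : E4) : dt x = x 0 := rfl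

/-- `dt (t, y) = t`. [folklore] -/
theorem dt_ofTimeSpace (t : ℝ) (y : E3) : dt (E4.ofTimeSpace t y) = t := rfl

/-- The linear inclusion `E3 → E4`, `v ↦ (0, v)` (the differential of the slice embeddings
`y ↦ (t, y)`). [folklore] -/
def incl : E3 →L[ℝ] E4 :=
  LinearMap.toContinuousLinearMap
    { toFun := E4.ofTimeSpace 0
      map_add' := fun _ _ ↦ by
        ext i
        refine Fin.cases ?_ (fun j ↦ ?_) i
        · simp
        · simp
      map_smul' := fun _ _ ↦ by
        ext i
        refine Fin.cases ?_ (fun j ↦ ?_) i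
        · simp
        · simp }

/-- `incl v = (0, v)`. [folklore] -/
@[simp]
theorem incl_apply (v : E3) : incl v = E4.ofTimeSpace 0 v := rfl

/-- `⇑incl = E4.ofTimeSpace 0`. [folklore] -/
theorem coe_incl : (incl : E3 → E4) = E4.ofTimeSpace 0 := rfl

/-- **Pythagoras for the time/space splitting**: `‖x‖² = (x 0)² + ‖spatial x‖²`. [folklore] -/
theorem norm_sq_eq (x : E4) : ‖x‖ ^ 2 = (x 0) ^ 2 + ‖E4.spatial x‖ ^ 2 := by
  rw [EuclideanSpace.norm_sq_eq, EuclideanSpace.norm_sq_eq, Fin.sum_univ_succ]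
  simp [E4.spatial_apply]

/-- `‖(t, y)‖² = t² + ‖y‖²`. [folklore] -/
theorem norm_ofTimeSpace_sq (t : ℝ) (y : E3) : ‖E4.ofTimeSpace t y‖ ^ 2 = t ^ 2 + ‖y‖ ^ 2 := by
  rw [norm_sq_eq, E4.spatial_ofTimeSpace]
  simp

/-- `‖spatial x‖ ≤ ‖x‖`. [folklore] -/
theorem norm_spatial_le (x : E4) : ‖E4.spatial x‖ ≤ ‖x‖ := by
  have h := norm_sq_eq x
  have h1 : ‖E4.spatial x‖ ^ 2 ≤ ‖x‖ ^ 2 := by nlinarith [sq_nonneg (x 0)]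
  exact (pow_le_pow_iff_left₀ (norm_nonneg _) (norm_nonneg _) two_ne_zero).1 h1

/-- `‖spatial x - spatial a‖ ≤ ‖x - a‖`. [folklore] -/
theorem norm_spatial_sub_le (x a : E4) : ‖E4.spatial x - E4.spatial a‖ ≤ ‖x - a‖ := by
  rw [← map_sub]
  exact norm_spatial_le _

/-! ### Star-shaped lenses over a slice point are connected -/

/-- **The lens over a slice point is star-shaped, hence connected.** For `a ∈ E4` with `a 0 = 0`,
`k ≥ 0` and `δ > 0`, the set `{x : ‖x - a‖ < ρ ∧ |x 0| + k ‖x - a‖ < δ}` is star-convex about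
`a` (along `a + s(x - a)` both quantities scale by `s`) and therefore connected. These are the
lens-shaped regions of Hawking–Ellis 1973, §7.4, p. 234, Fig. 48. [cite: HawkingEllis1973CUP, §7.4, p. 234 and Fig. 48] -/
theorem isConnected_lens {a : E4} (ha : a 0 = 0) {k ρ δ : ℝ} (hk : 0 ≤ k) (hρ : 0 < ρ)
    (hδ : 0 < δ) :
    IsConnected {x : E4 | ‖x - a‖ < ρ ∧ |x 0| + k * ‖x - a‖ < δ} := by
  have ha' : a ∈ {x : E4 | ‖x - a‖ < ρ ∧ |x 0| + k * ‖x - a‖ < δ} := by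
    refine ⟨by simpa using hρ, ?_⟩
    simp [ha, hδ]
  have hstar : StarConvex ℝ a {x : E4 | ‖x - a‖ < ρ ∧ |x 0| + k * ‖x - a‖ < δ} := by
    intro x hx s t hs ht hst
    obtain ⟨hx1, hx2⟩ := hx
    have hs' : s = 1 - t := by linarith
    have ht1 : t ≤ 1 := by linarith
    have heq : s • a + t • x - a = t • (x - a) := by
      rw [hs', sub_smul, one_smul, smul_sub]; abel
    refine ⟨?_, ?_⟩
    · show ‖s • a + t • x - a‖ < ρ
      rw [heq, norm_smul, Real.norm_of_nonneg ht]
      calc t * ‖x - a‖ ≤ 1 * ‖x - a‖ := mul_le_mul_of_nonneg_right ht1 (norm_nonneg _)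
        _ = ‖x - a‖ := one_mul _
        _ < ρ := hx1
    · show |(s • a + t • x) 0| + k * ‖s • a + t • x - a‖ < δ
      have h0 : (s • a + t • x) 0 = t * (x 0) := by
        simp [ha]
      rw [h0, heq, norm_smul, Real.norm_of_nonneg ht, abs_mul, abs_of_nonneg ht]
      have h1 : t * |x 0| + k * (t * ‖x - a‖) = t * (|x 0| + k * ‖x - a‖) := by ring
      rw [h1]
      calc t * (|x 0| + k * ‖x - a‖) ≤ 1 * (|x 0| + k * ‖x - a‖) :=
            mul_le_mul_of_nonneg_right ht1 (by positivity)
        _ = |x 0| + k * ‖x - a‖ := one_mul _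
        _ < δ := hx2
  exact ⟨⟨a, ha'⟩, (hstar.isPathConnected ha').isConnected.isPreconnected⟩

/-! ### The slice embedding of a chart domain of `E3` into a chart domain of `E4` -/

variable {T : Opens E4} {B : Opens E3}

/-- The **slice embedding** `ι : B → T`, `y ↦ (0, y)`, of a chart domain `B ⊆ E3` into a chart
domain `T ⊆ E4` containing the slice piece `{0} × B`. Wald 1984, §10.2 (the hypersurfaces
`Σ_t`); Hawking–Ellis 1973, §7.4 (`ℋ(0) = {t = 0}`). [cite: Wald1984, §10.2] -/
def sliceEmbed (hBT : ∀ y ∈ B, E4.ofTimeSpace 0 y ∈ T) : B → T :=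
  fun y ↦ ⟨E4.ofTimeSpace 0 y, hBT y y.2⟩

variable {hBT : ∀ y ∈ B, E4.ofTimeSpace 0 y ∈ T}

/-- Unfolding lemma: `ι y = (0, y)` in `E4`. [folklore] -/
@[simp]
theorem coe_sliceEmbed (y : B) : (sliceEmbed hBT y : E4) = E4.ofTimeSpace 0 y := rfl

/-- The slice embedding is injective. [folklore] -/
theorem injective_sliceEmbed : Injective (sliceEmbed hBT) := fun _ _ h ↦
  Subtype.ext (E4.ofTimeSpace_injective 0 (congrArg Subtype.val h))

/-- `y ↦ (0, y)` is `C^n` for every `n` (it is a continuous linear map). [folklore] -/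
theorem contDiff_ofTimeSpace_zero {n : WithTop ℕ∞} : ContDiff ℝ n (E4.ofTimeSpace 0) := by
  rw [← coe_incl]
  exact incl.contDiff

/-- `y ↦ (0, y)` has derivative `incl` everywhere. [folklore] -/
theorem hasFDerivAt_ofTimeSpace_zero (y : E3) : HasFDerivAt (E4.ofTimeSpace 0) incl y := by
  rw [← coe_incl]
  exact incl.hasFDerivAt

/-- `D(y ↦ (0, y)) = incl`. [folklore] -/
theorem fderiv_ofTimeSpace_zero (y : E3) : fderiv ℝ (E4.ofTimeSpace 0) y = incl :=
  (hasFDerivAt_ofTimeSpace_zero y).fderiv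

/-- The slice embedding is `C^n` as a map of manifolds, for every `n` (its composite with the
inclusion `T ⊆ E4` is `y ↦ (0, y)` on the open set `B`). [folklore] -/
theorem contMDiff_sliceEmbed (n : ℕ∞ω) : ContMDiff 𝓘(ℝ, E3) 𝓘(ℝ, E4) n (sliceEmbed hBT) := by
  intro y
  refine (ChartedSpace.liftPropWithinAt_subtypeVal_comp_iff (sliceEmbed hBT) Set.univ y).mp ?_
  have h : ContMDiff 𝓘(ℝ, E3) 𝓘(ℝ, E4) n (E4.ofTimeSpace 0 ∘ (Subtype.val : B → E3)) :=
    (contMDiff_iff_contDiff.2 contDiff_ofTimeSpace_zero).comp contMDiff_subtype_val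
  exact h y

/-- The slice embedding is continuous. [folklore] -/
theorem continuous_sliceEmbed : Continuous (sliceEmbed hBT) :=
  (contMDiff_sliceEmbed 0).continuous

/-- **The differential of the slice embedding is the inclusion** `v ↦ (0, v)`. [folklore] -/
theorem mfderiv_sliceEmbed_apply (y : B) (v : E3) :
    mfderiv 𝓘(ℝ, E3) 𝓘(ℝ, E4) (sliceEmbed hBT) y v = E4.ofTimeSpace 0 v := by
  rw [OpensChart.mfderiv_apply_of_repr (f := sliceEmbed hBT) (Φ := E4.ofTimeSpace 0)
    (fun _ ↦ rfl) (hasFDerivAt_ofTimeSpace_zero _).differentiableAt, fderiv_ofTimeSpace_zero]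
  rfl

/-- The differential of the slice embedding is injective at every point. [folklore] -/
theorem injective_mfderiv_sliceEmbed (y : B) :
    Injective (mfderiv 𝓘(ℝ, E3) 𝓘(ℝ, E4) (sliceEmbed hBT) y) := by
  intro v w h
  have h' : E4.ofTimeSpace 0 v = E4.ofTimeSpace 0 w := by
    rw [← mfderiv_sliceEmbed_apply y v, ← mfderiv_sliceEmbed_apply y w]
    exact h
  exact E4.ofTimeSpace_injective 0 h'

/-- The slice embedding is a topological embedding (the continuous map `E4.spatial ∘ Subtype.val`
is a left inverse). [folklore] -/
theorem isEmbedding_sliceEmbed : Topology.IsEmbedding (sliceEmbed hBT) := by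
  have h0 : Topology.IsEmbedding (E4.ofTimeSpace 0) :=
    Topology.IsEmbedding.of_leftInverse (f := E4.spatial) (fun y ↦ E4.spatial_ofTimeSpace 0 y)
      E4.spatial.continuous (E4.continuous_ofTimeSpace 0)
  have h1 : Topology.IsEmbedding (Subtype.val ∘ sliceEmbed hBT) :=
    h0.comp Topology.IsEmbedding.subtypeVal
  exact Topology.IsEmbedding.of_comp continuous_sliceEmbed continuous_subtype_val h1

/-- **The slice embedding is a smooth embedding** in Mathlib's sense (immersion + topological
embedding): an injective-differential `C^∞` map is an immersion
(`isImmersion_of_injective_mfderiv`). Hawking–Ellis 1973, §2.3, p. 23. [cite: HawkingEllis1973CUP, §2.3, p. 23] -/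
theorem isSmoothEmbedding_sliceEmbed :
    Manifold.IsSmoothEmbedding 𝓘(ℝ, E3) 𝓘(ℝ, E4) ∞ (sliceEmbed hBT) :=
  ⟨Literature.Topology.FourManifolds.isImmersion_of_injective_mfderiv (contMDiff_sliceEmbed ∞)
    (by simp) injective_mfderiv_sliceEmbed, isEmbedding_sliceEmbed⟩

/-- **The image of the slice embedding**: `x ∈ ι(B)` iff `x 0 = 0` and `spatial x ∈ B`. [folklore] -/
theorem mem_range_sliceEmbed_iff {x : T} :
    x ∈ range (sliceEmbed hBT) ↔ (x : E4) 0 = 0 ∧ E4.spatial (x : E4) ∈ B := by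
  constructor
  · rintro ⟨y, rfl⟩
    exact ⟨rfl, by rw [coe_sliceEmbed, E4.spatial_ofTimeSpace]; exact y.2⟩
  · rintro ⟨h0, hB⟩
    refine ⟨⟨E4.spatial (x : E4), hB⟩, Subtype.ext ?_⟩
    rw [coe_sliceEmbed]
    have h := E4.ofTimeSpace_time_spatial (x : E4)
    rw [E4.time_apply, h0] at h
    exact h

/-! ### The normal field of the slice -/

variable (hBT) (G : E4 → E4 →L[ℝ] E4 →L[ℝ] ℝ)

/-- The **normal field of the slice** along `ι`: `ν y = N_{(0,y)} = -♯dt/√lapseSq`, the slice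
normal of the coordinate metric `G` (`MetricCoord.sliceNormal`). Wald 1984, §10.2, (10.2.10).
[cite: Wald1984, §10.2, (10.2.10)] -/
def sliceNormalField : NormalField 𝓘(ℝ, E4) (sliceEmbed hBT) :=
  fun y ↦ (MetricCoord.sliceNormal G dt (E4.ofTimeSpace 0 y) : E4)

variable {hBT G}

/-- Unfolding lemma for `sliceNormalField`. [folklore] -/
theorem sliceNormalField_apply (y : B) :
    sliceNormalField hBT G y = MetricCoord.sliceNormal G dt (E4.ofTimeSpace 0 y) := rfl

variable {g : LorentzianMetric 𝓘(ℝ, E4) ∞ T} (hG : ∀ x : T, g.val x = G x)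

include hG

/-- Applied form of `hG` for model-space vectors. [folklore] -/
theorem val_apply_eq (x : T) (u w : E4) : g.val x u w = G x u w :=
  congrArg (fun B : TangentSpace 𝓘(ℝ, E4) x →L[ℝ] TangentSpace 𝓘(ℝ, E4) x →L[ℝ] ℝ ↦ B u w) (hG x)

/-- **The slice normal is normal to the slice**: `g(ν y, dι v) = 0` (`dι v = (0, v) ∈ ker dt`).
Wald 1984, §10.2. [cite: Wald1984, §10.2, (10.2.10)] -/
theorem isNormalTo_sliceNormalField :
    g.toPseudoRiemannianMetric.IsNormalTo 𝓘(ℝ, E3) (sliceEmbed hBT) (sliceNormalField hBT G) := by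
  intro y v
  have hinv : (G (sliceEmbed hBT y)).IsInvertible :=
    OpensChart.isInvertible_repr (g := g.toPseudoRiemannianMetric) hG _
  show g.val (sliceEmbed hBT y) (sliceNormalField hBT G y)
    (mfderiv 𝓘(ℝ, E3) 𝓘(ℝ, E4) (sliceEmbed hBT) y v) = 0
  rw [mfderiv_sliceEmbed_apply, val_apply_eq hG, sliceNormalField_apply]
  exact MetricCoord.apply_sliceNormal_of_mem_ker hinv (dt_ofTimeSpace 0 v)

/-- **The slice normal is a unit timelike normal**: `g(ν, ν) = -1` where `lapseSq > 0` along the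
slice. Wald 1984, §10.2, (10.2.10). [cite: Wald1984, §10.2, (10.2.10)] -/
theorem isUnitNormal_sliceNormalField
    (hlapse : ∀ y : B, 0 < MetricCoord.lapseSq G dt (E4.ofTimeSpace 0 y)) :
    g.toPseudoRiemannianMetric.IsUnitNormal 𝓘(ℝ, E3) (sliceEmbed hBT) (sliceNormalField hBT G)
      (-1) := by
  refine ⟨isNormalTo_sliceNormalField hG, fun y ↦ ?_⟩
  have hinv : (G (sliceEmbed hBT y)).IsInvertible :=
    OpensChart.isInvertible_repr (g := g.toPseudoRiemannianMetric) hG _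
  show g.val (sliceEmbed hBT y) (sliceNormalField hBT G y) (sliceNormalField hBT G y) = -1
  rw [val_apply_eq hG, sliceNormalField_apply]
  exact MetricCoord.apply_sliceNormal_self hinv (hlapse y)

/-- **The slice is spacelike**: `ι^* g` is positive definite where `lapseSq > 0` (the tangent
space `dι(T_y B) ⊆ ν^⊥` of the slice is the orthogonal complement of the timelike `ν`, hence
spacelike; O'Neill 1983, Ch. 5, Lemma 5.26, here the structure field
`LorentzianMetric.pos_of_orthogonal`). [cite: ONeillSemiRiemannian1983, Ch. 5, Lemma 5.26 (p. 141)] -/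
theorem isSpacelikeImmersion_sliceEmbed
    (hlapse : ∀ y : B, 0 < MetricCoord.lapseSq G dt (E4.ofTimeSpace 0 y)) :
    g.toPseudoRiemannianMetric.IsSpacelikeImmersion 𝓘(ℝ, E3) (sliceEmbed hBT) := by
  refine ⟨contMDiff_sliceEmbed _, fun y v hv ↦ ?_⟩
  have hunit := (isUnitNormal_sliceNormalField (hBT := hBT) hG hlapse).2 y
  have hnormal := isNormalTo_sliceNormalField (hBT := hBT) hG y v
  have hne : mfderiv 𝓘(ℝ, E3) 𝓘(ℝ, E4) (sliceEmbed hBT) y v ≠ 0 := fun h ↦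
    hv (injective_mfderiv_sliceEmbed y (by rw [h, map_zero]))
  rw [PseudoRiemannianMetric.inducedBilin_apply]
  exact g.pos_of_orthogonal (sliceEmbed hBT y) _ _ (by rw [hunit]; norm_num) hnormal hne

/-- **The slice normal is the future unit normal**, given that it is future-directed (for the
transported structure of a time function this is `CoordChart.isFutureDirected_sliceNormal_metricRepr`).
Wald 1984, §10.2. [cite: Wald1984, §10.2, (10.2.10)] -/
theorem isFutureUnitNormal_sliceNormalField (τ : TimeOrientation g)
    (hlapse : ∀ y : B, 0 < MetricCoord.lapseSq G dt (E4.ofTimeSpace 0 y))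
    (hfut : ∀ y : B, τ.IsFutureDirected (x := sliceEmbed hBT y) (sliceNormalField hBT G y)) :
    g.IsFutureUnitNormal 𝓘(ℝ, E3) τ (sliceEmbed hBT) (sliceNormalField hBT G) :=
  ⟨isUnitNormal_sliceNormalField hG hlapse, hfut⟩

/-- **The lift `y ↦ (ι y, ν y)` of the slice normal to `TT` is `C^∞`** where `lapseSq > 0`
(the slice normal is a smooth function of the smooth components `G`,
`IsMetricOn.contDiffAt_sliceNormal`; the tangent bundle of a chart domain is trivial,
`OpensChart.contMDiff_lift_of_contDiffOn`). O'Neill 1983, Ch. 4, Lemma 4.19 ff. [cite: ONeillSemiRiemannian1983, Ch. 4, Lemma 4.19] -/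
theorem contMDiff_lift_sliceNormalField
    (hlapse : ∀ y : B, 0 < MetricCoord.lapseSq G dt (E4.ofTimeSpace 0 y)) :
    ContMDiff 𝓘(ℝ, E3) 𝓘(ℝ, E4).tangent ∞
      (fun y ↦ (TotalSpace.mk' E4 (sliceEmbed hBT y) (sliceNormalField hBT G y) :
        TangentBundle 𝓘(ℝ, E4) T)) := by
  have hmet : MetricCoord.IsMetricOn G (T : Set E4) :=
    OpensChart.isMetricOn_repr (g := g.toPseudoRiemannianMetric) hG
  refine OpensChart.contMDiff_lift_of_contDiffOn (contMDiff_sliceEmbed ∞)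
    (N := fun y ↦ MetricCoord.sliceNormal G dt (E4.ofTimeSpace 0 y)) (fun _ ↦ rfl) ?_
  intro y hy
  have h1 : ContDiffAt ℝ ∞ (MetricCoord.sliceNormal G dt) (E4.ofTimeSpace 0 y) :=
    hmet.contDiffAt_sliceNormal (hBT y hy) (hlapse ⟨y, hy⟩)
  exact (h1.comp y contDiff_ofTimeSpace_zero.contDiffAt).contDiffWithinAt

omit hG in
/-- The slice normal field is differentiable along the slice embedding as a map into `TT` (the
displayed hypothesis `hν` of `DataEmbedding.restrict`), being `C^∞`. [folklore] -/
theorem mdifferentiableAt_lift_sliceNormalField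
    (h : ContMDiff 𝓘(ℝ, E3) 𝓘(ℝ, E4).tangent ∞
      (fun y ↦ (TotalSpace.mk' E4 (sliceEmbed hBT y) (sliceNormalField hBT G y) :
        TangentBundle 𝓘(ℝ, E4) T))) (y : B) :
    MDifferentiableAt 𝓘(ℝ, E3) 𝓘(ℝ, E4).tangent
      (fun y ↦ (TotalSpace.mk' E4 (sliceEmbed hBT y) (sliceNormalField hBT G y) :
        TangentBundle 𝓘(ℝ, E4) T)) y :=
  (h y).mdifferentiableAt (by simp)

/-! ### The induced initial data set on the slice -/

/-- **The initial data set induced on the slice**: where `lapseSq > 0` along `ι(B)`, the pair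
`(ι^* g, K_ν)` is an `InitialDataSet` on `B` — `h = ι^* g` the induced Riemannian metric,
`k = K_ν` the second fundamental form w.r.t. `ν` (`K_ν(v, w) = g(D_v ν, dι w)`)
(`PseudoRiemannianMetric.exists_initialDataSet_induced`). O'Neill 1983, Ch. 4, Lemma 4.4;
Choquet-Bruhat 2009, Ch. VI, §2–3; Wald 1984, (10.2.13). [cite: ONeillSemiRiemannian1983, Ch. 4, Lemma 4.4] -/
theorem exists_initialDataSet [g.toPseudoRiemannianMetric.HasLeviCivita]
    (hlapse : ∀ y : B, 0 < MetricCoord.lapseSq G dt (E4.ofTimeSpace 0 y)) :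
    ∃ D : InitialDataSet 𝓘(ℝ, E3) B,
      (∀ y : B, D.h.inner y =
        pullbackBilin (I := 𝓘(ℝ, E4)) (I' := 𝓘(ℝ, E3)) (sliceEmbed hBT) g.val y) ∧
      ∀ y : B, (D.k y).toLinearMap₁₂ =
        g.toPseudoRiemannianMetric.secondFundamentalForm 𝓘(ℝ, E3) (sliceEmbed hBT)
          (sliceNormalField hBT G) y := by
  obtain ⟨D, hDh, hDk⟩ := g.toPseudoRiemannianMetric.exists_initialDataSet_induced
    (isSpacelikeImmersion_sliceEmbed hG hlapse) (isNormalTo_sliceNormalField hG)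
    (contMDiff_lift_sliceNormalField hG hlapse)
  refine ⟨D, fun y ↦ ?_, hDk⟩
  rw [hDh, PseudoRiemannianMetric.inducedRiemannianMetric_inner]
  rfl

end CoordSlice

end Literature.Geometry.Lorentzian

end
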